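import Mathlib
import Summits.ValiantsHypothesis.ValiantsHypothesis.Theses.ValuativeGCT

/-!
# Sketch — crux-ideate `stmt-ValiantsHypothesis-12626` (`ValuativeGCT.CutBites`), ideator 3, round 1

First lemmas of the two idea cards `Ideas/grassmann-point-stability.md` and
`Ideas/staircase-quadric.md`, typed over the crux's own `let`-blocks (copied verbatim into the
abbreviations `skewU`, `LLambda`, `stabInv`, `borelSemiInv`, `Tspace` below, so that
`Tspace m δ t lam` is literally the crux's `T t` at weight `lam`).  Nothing here is proved; the
file only has to elaborate (`lean check` rc 0, no `sorry`).
-/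

namespace Summit.ValiantsHypothesis.ValiantsHypothesis.Cruxes.CutBites.Sketch

open Literature.NumberTheory.DiophantineGeometry Literature.Computability.AlgebraicComplexity

noncomputable section

/-- The skew-symmetric Edmonds-gap space `Λ_m ⊂ k^{MatIdx m}` (the crux's `U`). -/
def skewU (m : ℕ) : Submodule ℂ (MatIdx m → ℂ) :=
  Submodule.span ℂ {u : MatIdx m → ℂ | ∀ a b : Fin m, u (toLex (a, b)) = -u (toLex (b, a))}

/-- The locus `L_Λ = {A : every row of A lies in Λ_m}` inside `End(ℂ^{m×m})` (the crux's set). -/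
def LLambda (m : ℕ) : Set (MatIdx m × MatIdx m → ℂ) :=
  {p | ∀ j : MatIdx m, (fun i => p (j, i)) ∈ skewU m}

/-- Right invariance under the End-stabiliser of `det_m` (the crux's third factor). -/
def stabInv (m : ℕ) : Submodule ℂ (MvPolynomial (MatIdx m × MatIdx m) ℂ) :=
  ⨅ (M : Matrix (MatIdx m) (MatIdx m) ℂ) (_ : linSubst (MatIdx m) ℂ M (detFormLex ℂ m) = detFormLex ℂ m),
    LinearMap.ker ((MvPolynomial.aeval (R := ℂ) fun p : MatIdx m × MatIdx m =>
      ∑ l : MatIdx m, M l p.2 • MvPolynomial.X (p.1, l)).toLinearMap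
      - LinearMap.id (R := ℂ) (M := MvPolynomial (MatIdx m × MatIdx m) ℂ))

/-- Left `B`-semi-invariance of weight `χ` for the upper-triangular Borel (the crux's fourth factor). -/
def borelSemiInv (m : ℕ) (χ : Weight (MatIdx m)) : Submodule ℂ (MvPolynomial (MatIdx m × MatIdx m) ℂ) :=
  ⨅ (g : Matrix.GeneralLinearGroup (MatIdx m) ℂ) (_ : IsUpperTriangular g),
    LinearMap.ker ((MvPolynomial.aeval (R := ℂ) fun p : MatIdx m × MatIdx m =>
      ∑ l : MatIdx m, ((g⁻¹ : Matrix.GeneralLinearGroup (MatIdx m) ℂ) : Matrix (MatIdx m) (MatIdx m) ℂ) p.1 l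
        • MvPolynomial.X (l, p.2)).toLinearMap
      - weightChar χ g • LinearMap.id (R := ℂ) (M := MvPolynomial (MatIdx m × MatIdx m) ℂ))

/-- The crux's truncation `T t` in degree `m δ` at weight `lam*` (all four factors). -/
def Tspace (m δ t : ℕ) (lam : Nat.Partition (m * δ)) : Submodule ℂ (MvPolynomial (MatIdx m × MatIdx m) ℂ) :=
  MvPolynomial.homogeneousSubmodule (MatIdx m × MatIdx m) ℂ (m * δ)
    ⊓ ((MvPolynomial.vanishingIdeal ℂ (LLambda m)) ^ t).restrictScalars ℂ
    ⊓ stabInv m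
    ⊓ borelSemiInv m (Weight.dualOfPartition (m * m) lam).toMatIdx

/-- BOOKKEEPING (shared by both cards): an element of `T 0` that does not vanish at one point of
`L_Λ` is outside `P_Λ ⊇ P_Λ^δ` (`δ ≥ 1`), so `T δ < T 0` in `finrank` (both finite-dimensional,
inside the degree-`mδ` piece). -/
def OrderZeroWitnessGivesCut : Prop :=
  ∀ (m δ : ℕ) (lam : Nat.Partition (m * δ)), 0 < δ →
    (∃ G ∈ Tspace m δ 0 lam, ∃ p ∈ LLambda m, MvPolynomial.eval p G ≠ 0) →
    Module.finrank ℂ ↥(Tspace m δ δ lam) < Module.finrank ℂ ↥(Tspace m δ 0 lam)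

/-- FIRST LEMMA of card `grassmann-point-stability`: for odd `m ≥ 3` there is a RECTANGULAR
weight `lam = (c^r)`, `r = m(m-1)/2 = dim Λ_m`, `c r = m δ`, and an element of `T 0` at that
weight (a Stab(det_m)-invariant polynomial in the `r × r` minors of the bottom `r` rows, i.e. an
`S(GL_m × GL_m) ⋊ τ`-invariant form of degree `c` on `Λ^r(Mat_m)` pulled back along the Plücker
map) that does not vanish at a point of `L_Λ` (one whose bottom `r` rows span `Λ_m`).  Source of
the non-vanishing: the Plücker point `[Λ_m] ∈ Gr(r, Mat_m)` is polystable for `SL_m × SL_m`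
(Luna's criterion / Kempf's torus reduction + regular tournaments, `m` odd). -/
def RectangularOrderZeroWitness : Prop :=
  ∀ m : ℕ, Odd m → 3 ≤ m → ∃ (c δ : ℕ) (lam : Nat.Partition (m * δ)),
    0 < δ ∧ lam.parts = Multiset.replicate (m * (m - 1) / 2) c ∧
    ∃ G ∈ Tspace m δ 0 lam, ∃ p ∈ LLambda m, MvPolynomial.eval p G ≠ 0

/-- `RectangularOrderZeroWitness` plus the bookkeeping closes the crux (weights `(c^r)` have
`r = m(m-1)/2 ≤ m²` parts). -/
def RectangularLineCloses : Prop :=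
  OrderZeroWitnessGivesCut → RectangularOrderZeroWitness →
    Summit.ValiantsHypothesis.ValiantsHypothesis.Theses.ValuativeGCT.CutBites

/-- FIRST LEMMA of card `staircase-quadric`, representation-theoretic half made combinatorial:
the diagonal `SL_m` has a ONE-dimensional invariant space in `Λ^{m(m-1)/2}(V ⊗ V)`; by the
Cauchy decomposition `Λ^r(V ⊗ W) = ⊕_μ S_μ V ⊗ S_{μ'} W` this is the statement that the only
Young diagram `μ` inside the `m × m` box with `|μ| = m(m-1)/2` whose conjugate `μ'` agrees with
the `SL_m`-dual `μ^∨ = (μ₁ - μ_m, …, μ₁ - μ₁)` up to full columns is the staircase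
`(m-1, m-2, …, 1, 0)`.  Verified by enumeration for `3 ≤ m ≤ 11` (scratch/selfdual2.py);
0-indexed rows/columns as in Mathlib's `YoungDiagram`. -/
def UniqueDiagonalInvariantLine : Prop :=
  ∀ m : ℕ, 3 ≤ m → ∀ μ : YoungDiagram, μ.cells.card = m * (m - 1) / 2 →
    μ.rowLen 0 ≤ m → μ.colLen 0 ≤ m →
    (∃ k : ℕ, ∀ j : ℕ, j < m → μ.colLen j = μ.rowLen 0 - μ.rowLen (m - 1 - j) + k) →
    ∀ i : ℕ, μ.rowLen i = m - 1 - i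

/-- FIRST LEMMA of card `staircase-quadric`, crux-side form: the explicit witness lives at the
weight `(2^r)`, `r = m(m-1)/2`, degree `m(m-1)`, i.e. `δ = m - 1` (even): the canonical
invariant quadric of the self-dual staircase summand `S_ρ V ⊗ S_ρ W ⊂ Λ^r(V ⊗ W)`,
`ρ = (m-1, …, 1, 0)`, pulled back along the bottom-`r`-row Plücker map, is in `T 0` and is
non-zero at every point of `L_Λ` whose bottom `r` rows span `Λ_m`. -/
def StaircaseQuadricWitness : Prop :=
  ∀ m : ℕ, Odd m → 3 ≤ m → ∃ (lam : Nat.Partition (m * (m - 1))),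
    lam.parts = Multiset.replicate (m * (m - 1) / 2) 2 ∧
    ∃ G ∈ Tspace m (m - 1) 0 lam, ∃ p ∈ LLambda m, MvPolynomial.eval p G ≠ 0

/-- The staircase witness is a special case of the rectangular one (`c = 2`, `δ = m - 1 ≥ 2`). -/
def StaircaseLineCloses : Prop :=
  OrderZeroWitnessGivesCut → StaircaseQuadricWitness →
    Summit.ValiantsHypothesis.ValiantsHypothesis.Theses.ValuativeGCT.CutBites

/-- PARITY LAW (structural remark used by both cards, elementary): `τ ∈ Stab(det_m)` acts on
`Mat_m = Λ_m ⊕ Sym_m` by `(-1, +1)`, so every element of `T 0` has only EVEN degree in the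
`Λ`-coordinates; for `m` odd the order of vanishing along `L_Λ` is `≡ δ (mod 2)`, the filtration
`T t` jumps only at `t ≡ δ (mod 2)`, and for ODD `δ` every element of `T 0` vanishes on `L_Λ`
(`T 1 = T 0`).  Typed here in its weakest useful form. -/
def OddDeltaNoOrderZero : Prop :=
  ∀ (m δ : ℕ) (lam : Nat.Partition (m * δ)), Odd m → Odd δ →
    ∀ G ∈ Tspace m δ 0 lam, ∀ p ∈ LLambda m, MvPolynomial.eval p G = 0

end

end Summit.ValiantsHypothesis.ValiantsHypothesis.Cruxes.CutBites.Sketch
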